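import Mathlib
import HarnessLib
import Summits.Ventures.LatticeQCDFlow.Exactness.NCMCGeneralSpaceReplicaPooledGammaCoverage
import Summits.Ventures.LatticeQCDFlow.Exactness.NCMCGeneralSpaceReplicaVectorCLTChains
import Summits.Ventures.LatticeQCDFlow.Exactness.NCMCGeneralSpaceGammaCoverageUnconditional

/-!
# The NCMC lane over `R` independent replicas: the POOLED occupancy interval is asymptotically exact UNCONDITIONALLY, and the between-replica standard error of `target_means` has a random limit at fixed `R` — from EVERY family of initial states

HONEST FRAMING: exact (Metropolis-corrected) sampling algorithms for lattice gauge theory;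
figures of merit are autocorrelation/cost numbers at stated couplings and volumes; no
continuum-physics claim.

Venture `LatticeQCDFlow` (cell pub-lqcd), topic `Exactness`; FANOUT row 13 (`eng-snf`, GEN-23).
NEW WORK of the cell, not a published result; no definition is introduced; nothing is cited as a
fact.  `latflow-snf`'s `run_ncmc_chain` iterates the Metropolized one-way switch on a BATCH of `B`
replicas ("per iteration and replica", `snf/ncmc.py`) and `target_means` reports "mean and standard
error over the replicas that visited the target (independent chains)".  GEN-18…21 typed ONE replica:
the iteration kernel `Q = switchKernel ∘ₖ levelKernel` has a two-step Doeblin certificate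
`ε • ν ≤ Q²(z, ·)`, the occupancy `p̂_n → σ(c − ΔF)` from every start, its Γ-method interval is exact and
`τ_int(ρ_occ) > 0` automatically (GEN-21 `NCMCGeneralSpaceGammaCoverageUnconditional`).  With GEN-23's
replica files this gives, for the `R` INDEPENDENT replicas started from ANY states `z₀ r`:
(§1, any chain and any EVENT `A` with `0 < π(A) < 1`) the pooled frequency interval
`p̂_{R,n} ± z √(V̂_{R,n}/(R n))` is exact with NO variance hypothesis; (§2) the NCMC lane's pooled
occupancy interval about `σ(c − ΔF)` is exact from every family of initial states; (§3) the squared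
between-replica standard error of the replica occupancies, times `n`, converges in distribution to
`Σ_r (Z_r − Z̄)²/(R(R − 1))` with `Z ~ N(0, σ²_occ)^{⊗R}` — random at fixed `R`
(`NCMCGeneralSpaceReplicaVectorCLT`).

## Content

* **`tendsto_measure_pooledIndicatorMean_mem_gammaInterval_of_nHit`** — events, unconditional.
* **`CrooksPair.ncmc_pooledOccupancy_mem_gammaInterval_of_sq`** — the NCMC lane, pooled over replicas.
* **`CrooksPair.ncmc_occupancy_replicaSpreadVar_of_sq`** — the between-replica standard error's limit law.

NOT CLAIMED: the pooled `dF_occ` (logit) interval (one more delta-method step, as in GEN-20's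
`NCMCGeneralSpaceGammaMethodIntervalForm`; not typed here); dependent replicas; anything numerical.
-/

namespace Summit.Ventures.LatticeQCDFlow.Exactness.GeneralNCMC

open MeasureTheory ProbabilityTheory Set Filter Finset WithLp
open scoped ENNReal NNReal Topology

/-! ## §1 Pooled event frequencies: exact Γ-method coverage, unconditional -/

section Event

variable {S : Type*} [MeasurableSpace S]
  {κ : Kernel S S} [IsMarkovKernel κ] {π : Measure S} [IsProbabilityMeasure π]
  {ν : Measure S} [IsProbabilityMeasure ν] {ε : ℝ≥0∞} {m : ℕ}
  {ι : Type*} [Fintype ι] [Nonempty ι]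

/-- **THE POOLED FREQUENCY OF AN EVENT: EXACT Γ-METHOD COVERAGE WITH NO VARIANCE HYPOTHESIS.**
`κ` Markov, `π` invariant, `(nHit κ m)(z, ·) ≥ ε ν` (`ε ≠ 0`, `0 < m`), `A` measurable with
`0 < π(A) < 1`; windows `W_n → ∞`, `W_n³/n → 0`; `R = card ι` independent replicas from ANY laws `μ r`;
`z > 0`.  With `p̂_{R,n}` the pooled frequency of `A` and `V̂_{R,n}` the replica-averaged Γ-method
statistic of the 0/1 series: `P{ |p̂_{R,n} − π(A)| ≤ z √(V̂_{R,n}/(R n)) } → gaussianReal 0 1 (Icc (−z) z)`. -/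
theorem tendsto_measure_pooledIndicatorMean_mem_gammaInterval_of_nHit (hπ : Kernel.Invariant κ π)
    (hε : ε ≠ 0) (hmin : ∀ z, ε • ν ≤ nHit κ m z) (hm : 0 < m)
    {A : Set S} (hA : MeasurableSet A) (h0 : 0 < π.real A) (h1 : π.real A < 1)
    {W : ℕ → ℕ} (hW : Tendsto W atTop atTop) (hW3 : Tendsto (fun N => (W N : ℝ) ^ 3 / N) atTop (𝓝 0))
    (μ : ι → Measure S) [∀ r, IsProbabilityMeasure (μ r)] {z : ℝ} (hz : 0 < z)
    [∀ r, IsProbabilityMeasure (Kernel.trajMeasure (X := fun _ : ℕ => S) (μ r)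
        (fun n : ℕ => κ.comap (fun hh : (i : ↥(Finset.Iic n)) → S => hh ⟨n, Finset.mem_Iic.2 le_rfl⟩)
          (measurable_pi_apply _)))] :
    Tendsto (fun n : ℕ => (Measure.pi fun r => Kernel.trajMeasure (X := fun _ : ℕ => S) (μ r)
        (fun n : ℕ => κ.comap (fun hh : (i : ↥(Finset.Iic n)) → S => hh ⟨n, Finset.mem_Iic.2 le_rfl⟩)
          (measurable_pi_apply _)))
        {x : ι → ℕ → S | |(∑ r, ∑ t ∈ range n, A.indicator (1 : S → ℝ) (x r t))
            / ((Fintype.card ι : ℝ) * n) - π.real A|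
          ≤ z * Real.sqrt (((∑ r, Scoring.gammaHat (fun i => A.indicator (1 : S → ℝ) (x r i)) n 0
            * (2 * Scoring.tauIntWindow (Scoring.rhoHat (fun i => A.indicator (1 : S → ℝ) (x r i)) n)
              (W n))) / Fintype.card ι) / ((Fintype.card ι : ℝ) * n))})
      atTop (𝓝 (gaussianReal 0 1 (Icc (-z) z))) := by
  have hf : Measurable (A.indicator (1 : S → ℝ)) := measurable_one.indicator hA
  have hC : ∀ y, |A.indicator (1 : S → ℝ) y| ≤ 1 := fun y => by
    by_cases hy : y ∈ A <;> simp [hy]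
  have hmean : ∫ z, A.indicator (1 : S → ℝ) z ∂π = π.real A := integral_indicator_one hA
  have hσ := greenKubo_variance_indicator_pos_of_nHit hπ hε hmin hm hA h0 h1
  have h := tendsto_measure_pooledMean_mem_gammaInterval_of_nHit hπ hε hmin hm hf hC hσ hW hW3 μ hz
  rw [hmean] at h
  exact h

end Event

/-! ## §2 The NCMC lane pooled over independent replicas -/

section NCMC

variable {Ω E : Type*} [MeasurableSpace Ω] [MeasurableSpace E]
  {ν₀ ν₁ : Measure Ω} [IsFiniteMeasure ν₀] [IsFiniteMeasure ν₁]
  {κF κR : Kernel Ω E} [IsMarkovKernel κF] [IsMarkovKernel κR] {s e : E → Ω} {W : E → ℝ} {c : ℝ}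
  {T₀ T₁ : Kernel Ω Ω} [IsMarkovKernel T₀] [IsMarkovKernel T₁] {ε : ℝ≥0∞}
  {ν : Measure (Bool × Ω)} [IsProbabilityMeasure ν]
  {ι : Type*} [Fintype ι] [Nonempty ι]

/-- **THE NCMC LANE, `R` INDEPENDENT REPLICAS FROM ANY INITIAL STATES: THE POOLED OCCUPANCY INTERVAL IS
ASYMPTOTICALLY EXACT, UNCONDITIONALLY.**  Crooks pair, `T₀, T₁` leaving `ν₀, ν₁` invariant, two-step
certificate `ε • ν ≤ (nHit Q 2)(z, ·)` (`ε ≠ 0`) for `Q = switchKernel ∘ₖ levelKernel`,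
`e^{−ΔF} = Z₁/Z₀`; windows `W_n → ∞`, `W_n³/n → 0`; replica `r` started at ANY state `z₀ r`; `z > 0`.
With `p̂_{R,n}` the pooled target-level occupancy and `V̂_{R,n}` the replica-averaged Γ-method statistic
of the 0/1 occupancy series:
`P{ |p̂_{R,n} − σ(c − ΔF)| ≤ z √(V̂_{R,n}/(R n)) } → gaussianReal 0 1 (Icc (−z) z)`. -/
theorem CrooksPair.ncmc_pooledOccupancy_mem_gammaInterval_of_sq (h : CrooksPair ν₀ ν₁ κF κR s e W)
    (h0 : ν₀ univ ≠ 0) (h1 : ν₁ univ ≠ 0) (hT₀ : Kernel.Invariant T₀ ν₀)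
    (hT₁ : Kernel.Invariant T₁ ν₁) (hε : ε ≠ 0)
    (hD : haveI := isMarkovKernel_switchKernel (κF := κF) (κR := κR) (c := c)
              h.measurable_W h.measurable_s h.measurable_e
      ∀ z, ε • ν ≤ nHit (switchKernel κF κR c W s e ∘ₖ levelKernel T₀ T₁) 2 z)
    {ΔF : ℝ} (hΔF : Real.exp (-ΔF) = ((ν₀ univ)⁻¹ * ν₁ univ).toReal)
    {Wn : ℕ → ℕ} (hW : Tendsto Wn atTop atTop) (hW3 : Tendsto (fun N => (Wn N : ℝ) ^ 3 / N) atTop (𝓝 0))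
    (z₀ : ι → Bool × Ω) {z : ℝ} (hz : 0 < z)
    [hP : haveI := isMarkovKernel_switchKernel (κF := κF) (κR := κR) (c := c)
              h.measurable_W h.measurable_s h.measurable_e
      haveI := isMarkovKernel_levelKernel T₀ T₁
      ∀ r, IsProbabilityMeasure (Kernel.trajMeasure (X := fun _ : ℕ => Bool × Ω)
        (Measure.dirac (z₀ r))
        (fun n : ℕ => (switchKernel κF κR c W s e ∘ₖ levelKernel T₀ T₁).comap
          (fun hh : (j : ↥(Finset.Iic n)) → Bool × Ω => hh ⟨n, Finset.mem_Iic.2 le_rfl⟩)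
          (measurable_pi_apply _)))] :
    haveI := isMarkovKernel_switchKernel (κF := κF) (κR := κR) (c := c)
      h.measurable_W h.measurable_s h.measurable_e
    haveI := isMarkovKernel_levelKernel T₀ T₁
    Tendsto (fun n : ℕ => (Measure.pi fun r => Kernel.trajMeasure (X := fun _ : ℕ => Bool × Ω)
        (Measure.dirac (z₀ r))
        (fun n : ℕ => (switchKernel κF κR c W s e ∘ₖ levelKernel T₀ T₁).comap
          (fun hh : (j : ↥(Finset.Iic n)) → Bool × Ω => hh ⟨n, Finset.mem_Iic.2 le_rfl⟩)
          (measurable_pi_apply _)))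
        {x : ι → ℕ → Bool × Ω | |(∑ r, ∑ t ∈ range n, (targetLevel Ω).indicator (1 : Bool × Ω → ℝ)
            (x r t)) / ((Fintype.card ι : ℝ) * n) - Real.sigmoid (c - ΔF)|
          ≤ z * Real.sqrt (((∑ r, Scoring.gammaHat
              (fun i => (targetLevel Ω).indicator (1 : Bool × Ω → ℝ) (x r i)) n 0
            * (2 * Scoring.tauIntWindow (Scoring.rhoHat
              (fun i => (targetLevel Ω).indicator (1 : Bool × Ω → ℝ) (x r i)) n) (Wn n)))
                / Fintype.card ι) / ((Fintype.card ι : ℝ) * n))})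
      atTop (𝓝 (gaussianReal 0 1 (Icc (-z) z))) := by
  haveI := isMarkovKernel_switchKernel (κF := κF) (κR := κR) (c := c)
    h.measurable_W h.measurable_s h.measurable_e
  haveI := isMarkovKernel_levelKernel T₀ T₁
  haveI := isProbabilityMeasure_jointLaw c ν₀ ν₁ h0
  have hπ : Kernel.Invariant (switchKernel κF κR c W s e ∘ₖ levelKernel T₀ T₁)
      ((jointWeight c ν₀ ν₁ univ)⁻¹ • jointWeight c ν₀ ν₁) :=
    invariant_smul _ (iteration_invariant h hT₀ hT₁ c) _
  have hσeq := jointLaw_real_targetLevel c ν₀ ν₁ h0 h1 hΔF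
  have hp0 : 0 < ((jointWeight c ν₀ ν₁ univ)⁻¹ • jointWeight c ν₀ ν₁).real (targetLevel Ω) := by
    rw [hσeq]; exact Real.sigmoid_pos _
  have hp1 : ((jointWeight c ν₀ ν₁ univ)⁻¹ • jointWeight c ν₀ ν₁).real (targetLevel Ω) < 1 := by
    rw [hσeq]; exact Real.sigmoid_lt_one _
  have key := tendsto_measure_pooledIndicatorMean_mem_gammaInterval_of_nHit hπ hε hD (by norm_num)
    measurableSet_targetLevel hp0 hp1 hW hW3 (fun r => Measure.dirac (z₀ r)) hz
  rw [hσeq] at key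
  exact key

/-- **THE NCMC LANE: THE BETWEEN-REPLICA STANDARD ERROR OF THE REPLICA OCCUPANCIES HAS A RANDOM LIMIT
AT FIXED `R`** (`target_means`' "standard error over the replicas"): with `p̂_{r,n}` the occupancy of
replica `r` and `p̂̄_n` their average,
`n · Σ_r (p̂_{r,n} − p̂̄_n)²/(R(R − 1)) ⇒ Σ_r (Z_r − Z̄)²/(R(R − 1))`, `Z ~ N(0, σ²_occ)^{⊗R}`
(`σ²_occ` the Green–Kubo variance of the occupancy indicator along `Q`), every family of initial states. -/
theorem CrooksPair.ncmc_occupancy_replicaSpreadVar_of_sq (h : CrooksPair ν₀ ν₁ κF κR s e W)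
    (h0 : ν₀ univ ≠ 0) (hT₀ : Kernel.Invariant T₀ ν₀)
    (hT₁ : Kernel.Invariant T₁ ν₁) (hε : ε ≠ 0)
    (hD : haveI := isMarkovKernel_switchKernel (κF := κF) (κR := κR) (c := c)
              h.measurable_W h.measurable_s h.measurable_e
      ∀ z, ε • ν ≤ nHit (switchKernel κF κR c W s e ∘ₖ levelKernel T₀ T₁) 2 z)
    (z₀ : ι → Bool × Ω)
    [hP : haveI := isMarkovKernel_switchKernel (κF := κF) (κR := κR) (c := c)
              h.measurable_W h.measurable_s h.measurable_e
      haveI := isMarkovKernel_levelKernel T₀ T₁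
      ∀ r, IsProbabilityMeasure (Kernel.trajMeasure (X := fun _ : ℕ => Bool × Ω)
        (Measure.dirac (z₀ r))
        (fun n : ℕ => (switchKernel κF κR c W s e ∘ₖ levelKernel T₀ T₁).comap
          (fun hh : (j : ↥(Finset.Iic n)) → Bool × Ω => hh ⟨n, Finset.mem_Iic.2 le_rfl⟩)
          (measurable_pi_apply _)))] :
    haveI := isMarkovKernel_switchKernel (κF := κF) (κR := κR) (c := c)
      h.measurable_W h.measurable_s h.measurable_e
    haveI := isMarkovKernel_levelKernel T₀ T₁
    TendstoInDistribution (fun (n : ℕ) (x : ι → ℕ → Bool × Ω) =>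
        (n : ℝ) * ((∑ r, ((∑ t ∈ range n, (targetLevel Ω).indicator (1 : Bool × Ω → ℝ) (x r t)) / n
          - (∑ r', (∑ t ∈ range n, (targetLevel Ω).indicator (1 : Bool × Ω → ℝ) (x r' t)) / n)
            / Fintype.card ι) ^ 2) / ((Fintype.card ι : ℝ) * (Fintype.card ι - 1))))
      atTop (fun w : ι → ℝ => (∑ r, (w r - (∑ r', w r') / Fintype.card ι) ^ 2)
        / ((Fintype.card ι : ℝ) * (Fintype.card ι - 1)))
      (fun _ => Measure.pi fun r => Kernel.trajMeasure (X := fun _ : ℕ => Bool × Ω)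
        (Measure.dirac (z₀ r))
        (fun n : ℕ => (switchKernel κF κR c W s e ∘ₖ levelKernel T₀ T₁).comap
          (fun hh : (j : ↥(Finset.Iic n)) → Bool × Ω => hh ⟨n, Finset.mem_Iic.2 le_rfl⟩)
          (measurable_pi_apply _)))
      (Measure.pi fun _ : ι => gaussianReal 0 (Real.toNNReal
        (Scoring.autocov (switchKernel κF κR c W s e ∘ₖ levelKernel T₀ T₁)
            ((jointWeight c ν₀ ν₁ univ)⁻¹ • jointWeight c ν₀ ν₁)
            (fun y => (targetLevel Ω).indicator (1 : Bool × Ω → ℝ) y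
              - ∫ z, (targetLevel Ω).indicator (1 : Bool × Ω → ℝ) z
                ∂((jointWeight c ν₀ ν₁ univ)⁻¹ • jointWeight c ν₀ ν₁)) 0
          + 2 * ∑' t, Scoring.autocov (switchKernel κF κR c W s e ∘ₖ levelKernel T₀ T₁)
            ((jointWeight c ν₀ ν₁ univ)⁻¹ • jointWeight c ν₀ ν₁)
            (fun y => (targetLevel Ω).indicator (1 : Bool × Ω → ℝ) y
              - ∫ z, (targetLevel Ω).indicator (1 : Bool × Ω → ℝ) z
                ∂((jointWeight c ν₀ ν₁ univ)⁻¹ • jointWeight c ν₀ ν₁)) (t + 1)))) := by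
  haveI := isMarkovKernel_switchKernel (κF := κF) (κR := κR) (c := c)
    h.measurable_W h.measurable_s h.measurable_e
  haveI := isMarkovKernel_levelKernel T₀ T₁
  haveI := isProbabilityMeasure_jointLaw c ν₀ ν₁ h0
  have hπ : Kernel.Invariant (switchKernel κF κR c W s e ∘ₖ levelKernel T₀ T₁)
      ((jointWeight c ν₀ ν₁ univ)⁻¹ • jointWeight c ν₀ ν₁) :=
    invariant_smul _ (iteration_invariant h hT₀ hT₁ c) _
  have hf : Measurable ((targetLevel Ω).indicator (1 : Bool × Ω → ℝ)) :=
    measurable_one.indicator measurableSet_targetLevel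
  have hC : ∀ y, |(targetLevel Ω).indicator (1 : Bool × Ω → ℝ) y| ≤ 1 := fun y => by
    by_cases hy : y ∈ targetLevel Ω <;> simp [hy]
  exact tendstoInDistribution_replicaSpreadVar_of_nHit hπ hε hD (by norm_num) hf hC
    (fun r => Measure.dirac (z₀ r))

end NCMC

end Summit.Ventures.LatticeQCDFlow.Exactness.GeneralNCMC
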